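import Literature.Analysis.FluidPDE.PlanarVorticityPeakFloor
import HarnessLib

/-!
# A floor for the swirl speed of a non-negative planar vorticity by its circulation and moment of
# inertia: the angular virial identity `∫ ω ⟪K₂ ∗ ω, x^⊥⟫ dx = Γ²/(4π)` and `‖K₂ ∗ ω‖_∞ ≥ Γ^{3/2}/(4π M^{1/2})`

Literature file (topic `Analysis/FluidPDE`), theorems only. Sources: P. K. Newton, *The N-Vortex
Problem* (Springer AMS 145, 2001), §2.1 — the scaling ("virial") invariant of point-vortex dynamics,
`I₀ = Σ_α Γ_α (x_α ẏ_α − y_α ẋ_α) = Σ_α Γ_α Im(z̄_α ż_α) ≡ const · Σ_{α≠β} Γ_α Γ_β` (after Chapman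
1978): pairing `α ↔ β` in `Σ Γ_αΓ_β x_α·(x_α − x_β)/|x_α − x_β|²` leaves `½ Σ_{α≠β} Γ_αΓ_β`; typed here
in its continuum form for `u = K₂ ∗ ω` (`K₂(z) = z^⊥/(2π|z|²)`):
**`∫ ω(x) ⟪u(x), x^⊥⟫ dx = (∫ω)²/(4π)`** (Fubini; the kernel `k(x, y) = ⟪K₂(x − y), x^⊥⟫` has
`k(x, y) − k(y, x)… = ⟪K₂(x − y), (x − y)^⊥⟫ = (2π)⁻¹` off the diagonal). A. J. Majda, A. L. Bertozzi,
*Vorticity and Incompressible Flow* (CUP 2002), §1.7 Prop. 1.14 (1.81) and §3.3 (tree: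
`PlanarVorticityMoments`, `PlanarVorticityMaxPrinciple`) for the viscous evolution; P. G. Saffman,
*Vortex Dynamics* (CUP 1992), §3.10 eqs. (23), (28) (`Γ R_g² = ∫|r − R̄|²ω`, `R_g² = 4νt + const`).

## What is typed

* `integral_mul_inner_biotSavart2D_perp_eq` — for a continuous `w ∈ L¹ ∩ L^∞(ℝ²)` with
  `∫|x||w| < ∞`: `∫ w(x) ⟪(K₂ ∗ w)(x), x^⊥⟫ dx = (∫ w)²/(4π)`;
* `sq_integral_le_four_pi_mul_of_norm_biotSavart2D_le` — for such `w ≥ 0` and any bound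
  `‖(K₂ ∗ w)(x)‖ ≤ U` on `ℝ²`: `(∫w)² ≤ 4π U ∫|x| w`;
  `pow_three_integral_le_of_norm_biotSavart2D_le` — with `∫|x|²w < ∞` too:
  **`(∫w)³ ≤ 16π² U² ∫|x|² w`**, i.e. `U ≥ Γ^{3/2}/(4π M^{1/2}) = Γ/(4π R_g)` (`R_g² = M/Γ`): the peak
  swirl speed is floored by the circulation and the gyration radius (for the Lamb–Oseen vortex of
  core `s`, `R_g = 2s^{1/2}` and the floor `Γ/(8π s^{1/2})` is `0.78×` its actual peak speed);
* `IsClassicalNSSolutionOn.pow_three_integral_planarVorticity_le_of_norm_le` — planar Navier–Stokes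
  on a convex time set (`ν ≥ 0`, curl-free force, rapidly decaying vorticity, `u = K₂ ∗ ω`,
  `ω(t₀) ≥ 0`): at every later `t ∈ S`, every bound `‖u(t, ·)‖ ≤ U` satisfies
  `Ω₂³ ≤ 16π² U² (M(t₀) + 4ν(t − t₀)Ω₂)`.

HONEST FRAMING (cell `ns-blowup`, bears_on LADDER-NS N1 crux `HeredityFromTwo`, readout half —
`stub_speed_floors`): a classical planar a-priori FLOOR, the companion of the ceiling
`PlanarVelocitySupBound`; read in the cell through Lundgren's transformation. Nothing here concerns
three-dimensional regularity.

## References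

* [Newton2001NVortex] P. K. Newton, *The N-Vortex Problem*, Applied Mathematical Sciences 145,
  Springer (2001), §2.1 (conserved quantities; the scaling invariant `I₀`, after Chapman 1978).
* [MajdaBertozziCUP2002] A. J. Majda, A. L. Bertozzi, CUP 2002 — §1.7 Prop. 1.14 (1.81) (held text
  p. 31); §3.3 before Cor. 3.3 (p. 105); §2.1 (2.10)–(2.11) (the kernel `K₂`, p. 43).
* [Saffman1992] P. G. Saffman, *Vortex Dynamics*, CUP 1992, §3.10 eqs. (23)–(28) (held text p. 65).
-/

noncomputable section

open Set Function Filter MeasureTheory Metric InnerProductSpace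
open scoped ContDiff RealInnerProductSpace Topology

namespace Literature.Analysis.FluidPDE

/-! ### The angular virial identity -/

section Static

variable {w : EuclideanSpace ℝ (Fin 2) → ℝ} {A : ℝ}

/-- The pairing identity of the kernel: `⟪K₂(x − y), x^⊥⟫ − ⟪K₂(x − y), y^⊥⟫ = (2π)⁻¹` for `x ≠ y`
(`⟪z^⊥/(2π|z|²), z^⊥⟫ = (2π)⁻¹`). [cite: MajdaBertozziCUP2002, §2.1 eqs. (2.10)–(2.11) (held text p. 43)] -/
private theorem inner_biotSavartKernel2D_perp_sub {x y : EuclideanSpace ℝ (Fin 2)} (hxy : x ≠ y) :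
    ⟪biotSavartKernel2D (x - y), perp x⟫ - ⟪biotSavartKernel2D (x - y), perp y⟫ =
      (2 * Real.pi)⁻¹ := by
  have hz : ‖x - y‖ ≠ 0 := norm_ne_zero_iff.2 (sub_ne_zero.2 hxy)
  rw [← inner_sub_right, ← perp_sub, biotSavartKernel2D, real_inner_smul_left, inner_perp_perp,
    real_inner_self_eq_norm_sq]
  field_simp

/-- The Biot–Savart kernel is odd. [cite: MajdaBertozziCUP2002, §2.1 eqs. (2.10)–(2.11) (held text p. 43)] -/
private theorem biotSavartKernel2D_neg' (z : EuclideanSpace ℝ (Fin 2)) :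
    biotSavartKernel2D (-z) = -biotSavartKernel2D z := by
  rw [biotSavartKernel2D, biotSavartKernel2D, norm_neg, perp_neg, smul_neg]

/-- The diagonal of `ℝ² × ℝ²` is a Lebesgue-null set. [folklore] -/
private theorem volume_prod_diagonal_eq_zero :
    (volume.prod volume : Measure (EuclideanSpace ℝ (Fin 2) × EuclideanSpace ℝ (Fin 2)))
      (Set.diagonal (EuclideanSpace ℝ (Fin 2))) = 0 := by
  rw [Measure.prod_apply isClosed_diagonal.measurableSet]
  have h : ∀ x : EuclideanSpace ℝ (Fin 2),
      (volume : Measure (EuclideanSpace ℝ (Fin 2))) (Prod.mk x ⁻¹' Set.diagonal (EuclideanSpace ℝ (Fin 2))) = 0 := by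
    intro x
    have : Prod.mk x ⁻¹' Set.diagonal (EuclideanSpace ℝ (Fin 2)) = {x} := by
      ext y; simp [Set.mem_diagonal_iff, eq_comm]
    rw [this, measure_singleton]
  simp_rw [h, lintegral_zero]

/-- Fubini bookkeeping for the angular virial identity: integrability of
`x ↦ w(x)⟪(K₂ ∗ w)(x), x^⊥⟫` and the value of its integral. [cite: Newton2001NVortex, §2.1 (scaling invariant I₀); MajdaBertozziCUP2002, §2.1 eqs. (2.10)–(2.11)] -/
private theorem angularVirial_aux (hw : Continuous w) (hwi : Integrable w)
    (hA : ∀ y, |w y| ≤ A) (hmom : Integrable fun x => ‖x‖ * w x) :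
    Integrable (fun x => w x * ⟪biotSavart2D w x, perp x⟫) ∧
      ∫ x, w x * ⟪biotSavart2D w x, perp x⟫ = (∫ x, w x) ^ 2 / (4 * Real.pi) := by
  set F : EuclideanSpace ℝ (Fin 2) × EuclideanSpace ℝ (Fin 2) → ℝ :=
    fun z => w z.1 * (w z.2 * ⟪biotSavartKernel2D (z.1 - z.2), perp z.1⟫) with hF
  -- measurability
  have hFmeas : Measurable F :=
    (hw.measurable.comp measurable_fst).mul
      ((hw.measurable.comp measurable_snd).mul
        ((measurable_biotSavartKernel2D.comp (measurable_fst.sub measurable_snd)).inner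
          ((continuous_perp).measurable.comp measurable_fst)))
  have hFm : AEStronglyMeasurable F (volume.prod volume) := hFmeas.aestronglyMeasurable
  -- integrability on the product (the majorant `|x||w x| · ‖w y K₂(x − y)‖`)
  set B : ℝ := (2 * Real.pi)⁻¹ *
    (A * (∫ z, indicator (Metric.ball (0 : EuclideanSpace ℝ (Fin 2)) 1) (fun z => ‖z‖⁻¹) z) +
      ∫ y, |w y|) with hB
  have hptwise : ∀ x y, ‖F (x, y)‖ ≤ ‖‖x‖ * w x‖ * ‖w y • biotSavartKernel2D (x - y)‖ := by
    intro x y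
    have h1 : |⟪biotSavartKernel2D (x - y), perp x⟫| ≤ ‖biotSavartKernel2D (x - y)‖ * ‖x‖ := by
      rw [← norm_perp x]; exact abs_real_inner_le_norm _ _
    calc ‖F (x, y)‖ = |w x| * (|w y| * |⟪biotSavartKernel2D (x - y), perp x⟫|) := by
          simp only [hF, Real.norm_eq_abs, abs_mul]
      _ ≤ |w x| * (|w y| * (‖biotSavartKernel2D (x - y)‖ * ‖x‖)) := by gcongr
      _ = ‖‖x‖ * w x‖ * ‖w y • biotSavartKernel2D (x - y)‖ := by
          rw [norm_mul, norm_norm, Real.norm_eq_abs, norm_smul, Real.norm_eq_abs]; ring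
  have hFi : Integrable F (volume.prod volume) := by
    rw [integrable_prod_iff hFm]
    constructor
    · refine Eventually.of_forall fun x => ?_
      refine Integrable.mono' (((integrable_biotSavart_integrand hwi hA x).norm).const_mul
        (‖‖x‖ * w x‖)) ?_ (Eventually.of_forall (hptwise x))
      exact (hFmeas.comp (measurable_const.prodMk measurable_id)).aestronglyMeasurable
    · refine Integrable.mono' (hmom.norm.mul_const B) hFm.norm.integral_prod_right'
        (Eventually.of_forall fun x => ?_)
      rw [Real.norm_eq_abs, abs_of_nonneg (integral_nonneg fun y => norm_nonneg _)]
      calc ∫ y, ‖F (x, y)‖ ≤ ∫ y, ‖‖x‖ * w x‖ * ‖w y • biotSavartKernel2D (x - y)‖ :=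
            integral_mono_of_nonneg (Eventually.of_forall fun y => norm_nonneg _)
              (((integrable_biotSavart_integrand hwi hA x).norm).const_mul _)
              (Eventually.of_forall (hptwise x))
        _ ≤ ‖‖x‖ * w x‖ * B := by
            rw [integral_const_mul]
            exact mul_le_mul_of_nonneg_left (integral_norm_biotSavart_integrand_le hwi hA x)
              (norm_nonneg _)
  -- pairing: `F(x, y) + F(y, x) = (2π)⁻¹ w(x) w(y)` off the diagonal
  have hpair : ∀ᵐ z ∂(volume.prod volume : Measure (EuclideanSpace ℝ (Fin 2) × EuclideanSpace ℝ (Fin 2))),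
      F z + F z.swap = (2 * Real.pi)⁻¹ * (w z.1 * w z.2) := by
    have hae := (measure_eq_zero_iff_ae_notMem.1 volume_prod_diagonal_eq_zero)
    filter_upwards [hae] with z hz
    have hne : z.1 ≠ z.2 := fun h => hz (Set.mem_diagonal_iff.2 h)
    simp only [hF, Prod.fst_swap, Prod.snd_swap]
    rw [show z.2 - z.1 = -(z.1 - z.2) by abel, biotSavartKernel2D_neg', inner_neg_left]
    have hk := inner_biotSavartKernel2D_perp_sub hne
    linear_combination (w z.1 * w z.2) * hk
  -- `2 ∫∫ F = (2π)⁻¹ Γ²`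
  have hswapInt : ∫ z, F z.swap ∂(volume.prod volume : Measure (EuclideanSpace ℝ (Fin 2) × EuclideanSpace ℝ (Fin 2))) =
      ∫ z, F z ∂(volume.prod volume) :=
    integral_prod_swap (μ := (volume : Measure (EuclideanSpace ℝ (Fin 2))))
      (ν := (volume : Measure (EuclideanSpace ℝ (Fin 2)))) F
  have hsum : ∫ z, F z + F z.swap ∂(volume.prod volume : Measure (EuclideanSpace ℝ (Fin 2) × EuclideanSpace ℝ (Fin 2))) =
      (∫ z, F z ∂(volume.prod volume)) + ∫ z, F z.swap ∂(volume.prod volume) :=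
    integral_add hFi hFi.swap
  have htwo : 2 * ∫ z, F z ∂(volume.prod volume) =
      (2 * Real.pi)⁻¹ * ((∫ x, w x) * ∫ x, w x) := by
    rw [two_mul, ← integral_prod_mul (μ := (volume : Measure (EuclideanSpace ℝ (Fin 2))))
      (ν := (volume : Measure (EuclideanSpace ℝ (Fin 2)))) w w, ← integral_const_mul,
      ← integral_congr_ae hpair, hsum, hswapInt]
  -- Fubini on the left
  rw [integral_prod F hFi] at htwo
  have e : ∀ x, ∫ y, F (x, y) = w x * ⟪biotSavart2D w x, perp x⟫ := fun x => by
    simp only [hF]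
    rw [integral_const_mul, real_inner_comm, biotSavart2D,
      ← integral_inner (integrable_biotSavart_integrand hwi hA x)]
    congr 1
    refine integral_congr_ae (Eventually.of_forall fun y => ?_)
    show w y * ⟪biotSavartKernel2D (x - y), perp x⟫ = ⟪perp x, w y • biotSavartKernel2D (x - y)⟫
    rw [real_inner_smul_right, real_inner_comm]
  have hInt : Integrable (fun x => w x * ⟪biotSavart2D w x, perp x⟫) := by
    have h := hFi.integral_prod_left
    simp_rw [e] at h
    exact h
  simp_rw [e] at htwo
  refine ⟨hInt, ?_⟩
  have hπ : Real.pi ≠ 0 := Real.pi_pos.ne'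
  field_simp at htwo ⊢
  linear_combination htwo

/-- **The angular virial identity of the planar Biot–Savart law**: for a continuous
`w ∈ L¹(ℝ²) ∩ L^∞(ℝ²)` with `∫ |x| |w| < ∞`,
`∫ w(x) ⟪(K₂ ∗ w)(x), x^⊥⟫ dx = (∫ w)²/(4π)` — the continuum form of the point-vortex invariant
`Σ_α Γ_α (x_α × ẋ_α) = const · Σ_{α≠β} Γ_αΓ_β`: by Fubini the left side is `∫∫ w(x)w(y)k(x, y)` with
`k(x, y) = ⟪K₂(x − y), x^⊥⟫`, and pairing `(x, y) ↔ (y, x)` (`K₂` odd) replaces `k` by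
`½(k(x, y) − ⟪K₂(x − y), y^⊥⟫) = (4π)⁻¹` off the (null) diagonal.
[cite: Newton2001NVortex, §2.1 (the scaling invariant I₀ of the N-vortex system, after Chapman 1978); MajdaBertozziCUP2002, §2.1 eqs. (2.10)–(2.11)] -/
theorem integral_mul_inner_biotSavart2D_perp_eq (hw : Continuous w) (hwi : Integrable w)
    (hA : ∀ y, |w y| ≤ A) (hmom : Integrable fun x => ‖x‖ * w x) :
    ∫ x, w x * ⟪biotSavart2D w x, perp x⟫ = (∫ x, w x) ^ 2 / (4 * Real.pi) :=
  (angularVirial_aux hw hwi hA hmom).2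

/-- **Swirl-speed floor, first-moment form**: for a continuous `0 ≤ w ∈ L¹ ∩ L^∞(ℝ²)` with
`∫|x| w < ∞` and any bound `‖(K₂ ∗ w)(x)‖ ≤ U` on `ℝ²`: `(∫ w)² ≤ 4π U ∫ |x| w`
(`Γ²/(4π) = ∫ w⟪u, x^⊥⟫ ≤ U ∫|x| w`).
[cite: Newton2001NVortex, §2.1 (scaling invariant I₀, continuum form); Saffman1992, §3.10 eq. (23)] -/
theorem sq_integral_le_four_pi_mul_of_norm_biotSavart2D_le (hw : Continuous w) (hwi : Integrable w)
    (hA : ∀ y, |w y| ≤ A) (h0 : ∀ x, 0 ≤ w x) (hmom : Integrable fun x => ‖x‖ * w x) {U : ℝ}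
    (hU : ∀ x, ‖biotSavart2D w x‖ ≤ U) :
    (∫ x, w x) ^ 2 ≤ 4 * Real.pi * U * ∫ x, ‖x‖ * w x := by
  obtain ⟨hInt, hid⟩ := angularVirial_aux hw hwi hA hmom
  have hle : ∫ x, w x * ⟪biotSavart2D w x, perp x⟫ ≤ ∫ x, U * (‖x‖ * w x) := by
    refine integral_mono hInt (hmom.const_mul U) fun x => ?_
    have h1 : ⟪biotSavart2D w x, perp x⟫ ≤ U * ‖x‖ := by
      calc ⟪biotSavart2D w x, perp x⟫ ≤ ‖biotSavart2D w x‖ * ‖perp x‖ := real_inner_le_norm _ _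
        _ ≤ U * ‖x‖ := by
            rw [norm_perp]; exact mul_le_mul_of_nonneg_right (hU x) (norm_nonneg _)
    calc w x * ⟪biotSavart2D w x, perp x⟫ ≤ w x * (U * ‖x‖) := mul_le_mul_of_nonneg_left h1 (h0 x)
      _ = U * (‖x‖ * w x) := by ring
  rw [hid, integral_const_mul] at hle
  have hπ : 0 < 4 * Real.pi := by positivity
  rw [div_le_iff₀ hπ] at hle
  linarith

/-- **Swirl-speed floor**: for a continuous `0 ≤ w ∈ L¹ ∩ L^∞(ℝ²)` with `∫|x| w, ∫|x|² w < ∞` and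
any bound `‖(K₂ ∗ w)(x)‖ ≤ U` on `ℝ²`: **`(∫ w)³ ≤ 16π² U² ∫|x|² w`**, i.e.
`U ≥ Γ^{3/2}/(4π M^{1/2}) = Γ/(4π R_g)` with `Γ = ∫w`, `M = ∫|x|²w = Γ R_g²` — from the first-moment
form and `∫|x| w ≤ ½(λ ∫|x|²w + λ⁻¹ ∫w)` at `λ = 4πU/Γ`.
[cite: Newton2001NVortex, §2.1 (scaling invariant I₀, continuum form); Saffman1992, §3.10 eq. (23)] -/
theorem pow_three_integral_le_of_norm_biotSavart2D_le (hw : Continuous w) (hwi : Integrable w)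
    (hA : ∀ y, |w y| ≤ A) (h0 : ∀ x, 0 ≤ w x) (hmom : Integrable fun x => ‖x‖ * w x)
    (hm2 : Integrable fun x => ‖x‖ ^ 2 * w x) {U : ℝ} (hU : ∀ x, ‖biotSavart2D w x‖ ≤ U) :
    (∫ x, w x) ^ 3 ≤ 16 * Real.pi ^ 2 * U ^ 2 * ∫ x, ‖x‖ ^ 2 * w x := by
  set Γ : ℝ := ∫ x, w x with hΓ
  set M : ℝ := ∫ x, ‖x‖ ^ 2 * w x with hM
  have hΓ0 : 0 ≤ Γ := integral_nonneg h0
  have hM0 : 0 ≤ M := integral_nonneg fun x => mul_nonneg (sq_nonneg _) (h0 x)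
  have hU0 : 0 ≤ U := (norm_nonneg _).trans (hU 0)
  have hπ : 0 < Real.pi := Real.pi_pos
  have h1 := sq_integral_le_four_pi_mul_of_norm_biotSavart2D_le hw hwi hA h0 hmom hU
  rw [← hΓ] at h1
  rcases hΓ0.eq_or_lt with hz | hpos
  · rw [← hz]; simp only [ne_eq, OfNat.ofNat_ne_zero, not_false_eq_true, zero_pow]; positivity
  rcases hU0.eq_or_lt with hUz | hUpos
  · -- `U = 0` forces `Γ = 0`
    exfalso
    rw [← hUz, mul_zero, zero_mul] at h1
    nlinarith
  -- `∫|x| w ≤ ½(κ M + κ⁻¹ Γ)` with `κ = 4πU/Γ`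
  set κ : ℝ := 4 * Real.pi * U / Γ with hκ
  have hκpos : 0 < κ := by positivity
  have hm1 : ∫ x, ‖x‖ * w x ≤ (κ * M + κ⁻¹ * Γ) / 2 := by
    have hpt : ∀ x, ‖x‖ * w x ≤ (κ * (‖x‖ ^ 2 * w x) + κ⁻¹ * w x) / 2 := by
      intro x
      have hsq : 0 ≤ (κ * ‖x‖ - 1) ^ 2 * w x := mul_nonneg (sq_nonneg _) (h0 x)
      have hk : κ⁻¹ * κ = 1 := inv_mul_cancel₀ hκpos.ne'
      have : ‖x‖ * w x * κ ≤ (κ * (‖x‖ ^ 2 * w x) * κ + w x) / 2 := by nlinarith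
      have h2 : ‖x‖ * w x ≤ (κ * (‖x‖ ^ 2 * w x) * κ + w x) / 2 / κ := by
        rw [le_div_iff₀ hκpos]; exact this
      calc ‖x‖ * w x ≤ (κ * (‖x‖ ^ 2 * w x) * κ + w x) / 2 / κ := h2
        _ = (κ * (‖x‖ ^ 2 * w x) + κ⁻¹ * w x) / 2 := by field_simp
    calc ∫ x, ‖x‖ * w x ≤ ∫ x, (κ * (‖x‖ ^ 2 * w x) + κ⁻¹ * w x) / 2 :=
          integral_mono hmom (((hm2.const_mul κ).add (hwi.const_mul κ⁻¹)).div_const 2) hpt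
      _ = (κ * M + κ⁻¹ * Γ) / 2 := by
          rw [integral_div, integral_add (hm2.const_mul κ) (hwi.const_mul κ⁻¹), integral_const_mul,
            integral_const_mul]
  -- combine: `Γ² ≤ 4πU · ½(κM + Γ/κ) = 8π²U²M/Γ + Γ²/2`
  have h2 : Γ ^ 2 ≤ 4 * Real.pi * U * ((κ * M + κ⁻¹ * Γ) / 2) :=
    h1.trans (mul_le_mul_of_nonneg_left hm1 (by positivity))
  have h3 : 4 * Real.pi * U * ((κ * M + κ⁻¹ * Γ) / 2) = 8 * Real.pi ^ 2 * U ^ 2 * M / Γ + Γ ^ 2 / 2 := by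
    rw [hκ]
    field_simp
    ring
  rw [h3] at h2
  have h4 : Γ ^ 2 / 2 ≤ 8 * Real.pi ^ 2 * U ^ 2 * M / Γ := by linarith
  rw [le_div_iff₀ hpos] at h4
  nlinarith

end Static

/-! ### The viscous evolution of the swirl-speed floor (MB Prop. 1.14 + minimum principle) -/

section Planar

variable {S : Set ℝ} {ν : ℝ} {f u : ℝ → EuclideanSpace ℝ (Fin 2) → EuclideanSpace ℝ (Fin 2)}
  {p : ℝ → EuclideanSpace ℝ (Fin 2) → ℝ}

/-- The scalar vorticity of a `C¹` planar field is continuous. [folklore] -/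
private theorem continuous_planarVorticity₃ {v : EuclideanSpace ℝ (Fin 2) → EuclideanSpace ℝ (Fin 2)}
    (hv : ContDiff ℝ 1 v) : Continuous (PlanarEigenmode.vorticity v) := by
  have hc : ∀ e : EuclideanSpace ℝ (Fin 2), Continuous fun x => fderiv ℝ v x e := fun e =>
    (hv.continuous_fderiv one_ne_zero).clm_apply continuous_const
  have hcomp : ∀ (e : EuclideanSpace ℝ (Fin 2)) (i : Fin 2), Continuous fun x => fderiv ℝ v x e i :=
    fun e i => (PiLp.continuous_apply _ _ i).comp (hc e)
  unfold PlanarEigenmode.vorticity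
  exact (hcomp _ 1).sub (hcomp _ 0)

/-- Uniform rapid decay gives decay of `|ω|` near spatial infinity, uniformly in time. [folklore] -/
private theorem decay_of_hasUniformRapidDecayOn₃ {S : Set ℝ}
    {w : ℝ → EuclideanSpace ℝ (Fin 2) → ℝ} (hw : HasUniformRapidDecayOn S w) (δ : ℝ) (hδ : 0 < δ) :
    ∃ R : ℝ, ∀ t ∈ S, ∀ x : EuclideanSpace ℝ (Fin 2), R ≤ ‖x‖ → |w t x| ≤ δ := by
  obtain ⟨C, hC0, hC⟩ := hw.norm_le_rpow 1
  refine ⟨C / δ, fun t ht x hx => ?_⟩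
  have h1 := hC t ht x
  rw [Real.norm_eq_abs, Nat.cast_one, Real.rpow_neg_one] at h1
  have hx0 : 0 < 1 + ‖x‖ := by positivity
  calc |w t x| ≤ C * (1 + ‖x‖)⁻¹ := h1
    _ ≤ δ := by
        rw [← div_eq_mul_inv, div_le_iff₀ hx0]
        have : C ≤ δ * ‖x‖ := by rwa [div_le_iff₀' hδ] at hx
        nlinarith

/-- A uniformly rapidly decaying planar vorticity is bounded, integrable, and has integrable first
and second moment densities at each time (`|w| ≤ C(1 + |x|)^{-5}`). [folklore] -/
private theorem moments_integrable_of_hasUniformRapidDecayOn {S : Set ℝ}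
    {w : ℝ → EuclideanSpace ℝ (Fin 2) → ℝ} (hw : HasUniformRapidDecayOn S w) {t : ℝ} (ht : t ∈ S)
    (hc : Continuous (w t)) :
    (∃ A : ℝ, ∀ x, |w t x| ≤ A) ∧
      Integrable (w t) (volume : Measure (EuclideanSpace ℝ (Fin 2))) ∧
      Integrable (fun x => ‖x‖ * w t x) (volume : Measure (EuclideanSpace ℝ (Fin 2))) ∧
      Integrable (fun x => ‖x‖ ^ 2 * w t x) (volume : Measure (EuclideanSpace ℝ (Fin 2))) := by
  obtain ⟨C, hC0, hC⟩ := hw.norm_le_rpow 5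
  have hfin : (Module.finrank ℝ (EuclideanSpace ℝ (Fin 2)) : ℝ) = 2 := by
    rw [finrank_euclideanSpace_fin]; norm_num
  have hx0 : ∀ x : EuclideanSpace ℝ (Fin 2), 0 < 1 + ‖x‖ := fun x => by positivity
  have hpow : ∀ (x : EuclideanSpace ℝ (Fin 2)) (k : ℕ), ‖x‖ ^ k ≤ (1 + ‖x‖) ^ (k : ℝ) := fun x k => by
    rw [Real.rpow_natCast]
    exact pow_le_pow_left₀ (norm_nonneg _) (by linarith [norm_nonneg x]) k
  refine ⟨⟨C, fun x => ?_⟩, integrable_of_norm_le_rpow_neg hc (C := C) (r := ((5 : ℕ) : ℝ))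
      (by rw [hfin]; norm_num) fun x => hC t ht x, ?_, ?_⟩
  · have h1 := hC t ht x
    rw [Real.norm_eq_abs] at h1
    refine h1.trans ?_
    have : (1 + ‖x‖) ^ (-((5 : ℕ) : ℝ)) ≤ 1 :=
      Real.rpow_le_one_of_one_le_of_nonpos (by linarith [norm_nonneg x]) (by norm_num)
    nlinarith
  · refine integrable_of_norm_le_rpow_neg (continuous_norm.mul hc) (C := C) (r := 4)
      (by rw [hfin]; norm_num) fun x => ?_
    rw [norm_mul, norm_norm]
    calc ‖x‖ * ‖w t x‖ ≤ (1 + ‖x‖) ^ ((1 : ℕ) : ℝ) * (C * (1 + ‖x‖) ^ (-((5 : ℕ) : ℝ))) :=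
          mul_le_mul (by simpa only [pow_one] using hpow x 1) (hC t ht x) (norm_nonneg _)
            (by positivity)
      _ = C * (1 + ‖x‖) ^ (-(4 : ℝ)) := by
          rw [mul_left_comm, ← Real.rpow_add (hx0 x)]; norm_num
  · refine integrable_of_norm_le_rpow_neg ((continuous_norm.pow 2).mul hc) (C := C) (r := 3)
      (by rw [hfin]; norm_num) fun x => ?_
    rw [norm_mul, norm_pow, norm_norm]
    calc ‖x‖ ^ 2 * ‖w t x‖ ≤ (1 + ‖x‖) ^ ((2 : ℕ) : ℝ) * (C * (1 + ‖x‖) ^ (-((5 : ℕ) : ℝ))) :=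
          mul_le_mul (hpow x 2) (hC t ht x) (norm_nonneg _) (by positivity)
      _ = C * (1 + ‖x‖) ^ (-(3 : ℝ)) := by
          rw [mul_left_comm, ← Real.rpow_add (hx0 x)]; norm_num

/-- **The viscous evolution of the swirl-speed floor.** Let `(u, p)` be a classical planar
Navier–Stokes solution on a convex time set `S` with `ν ≥ 0` and curl-free force, whose vorticity
`ω` has uniform rapid decay on `S` and whose velocity is the Biot–Savart velocity of its vorticity,
with `ω(t₀, ·) ≥ 0` at `t₀ ∈ S`. Then at every `t ≥ t₀` in `S`, every bound `‖u(t, ·)‖ ≤ U` on `ℝ²`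
satisfies **`Ω₂³ ≤ 16π² U² (M(t₀) + 4ν(t − t₀)Ω₂)`**, `Ω₂ = ∫ω(t₀)`, `M(t₀) = ∫|x|²ω(t₀)`: the
minimum principle keeps `ω(t) ≥ 0` (MB §3.3), the static floor at time `t` reads
`Ω₂(t)³ ≤ 16π²U²M(t)`, and `Ω₂(t) = Ω₂`, `M(t) = M(t₀) + 4ν(t − t₀)Ω₂` (MB Prop. 1.14 (1.81); Saffman
§3.10 (28), `R_g² = 4νt + const`). The peak speed can decay no faster than `Ω₂/(4π R_g(t))`.
[cite: MajdaBertozziCUP2002, §1.7 Prop. 1.14 eq. (1.81) (held text p. 31); §3.3 before Cor. 3.3 (p. 105); Saffman1992, §3.10 eqs. (23), (28); Newton2001NVortex, §2.1] -/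
theorem IsClassicalNSSolutionOn.pow_three_integral_planarVorticity_le_of_norm_le
    (h : IsClassicalNSSolutionOn S ν f u p) (hS : Convex ℝ S) (hν : 0 ≤ ν)
    (hcurl : ∀ t ∈ S, ∀ x, PlanarEigenmode.vorticity (f t) x = 0)
    (hω : HasUniformRapidDecayOn S (fun t x => PlanarEigenmode.vorticity (u t) x))
    (hBS : ∀ t ∈ S, ∀ x, u t x = biotSavart2D (PlanarEigenmode.vorticity (u t)) x) {t₀ : ℝ}
    (ht₀ : t₀ ∈ S) (h0 : ∀ x, 0 ≤ PlanarEigenmode.vorticity (u t₀) x) {t : ℝ} (ht : t ∈ S)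
    (htt : t₀ ≤ t) {U : ℝ} (hU : ∀ x, ‖u t x‖ ≤ U) :
    (∫ y, PlanarEigenmode.vorticity (u t₀) y) ^ 3 ≤
      16 * Real.pi ^ 2 * U ^ 2 * ((∫ y, ‖y‖ ^ 2 * PlanarEigenmode.vorticity (u t₀) y) +
        4 * ν * (t - t₀) * ∫ y, PlanarEigenmode.vorticity (u t₀) y) := by
  -- the vorticity stays non-negative (minimum principle on the slab `[t₀, t] ⊆ S`)
  have hlo : ∀ y, 0 ≤ PlanarEigenmode.vorticity (u t) y := by
    rcases eq_or_lt_of_le htt with he | hlt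
    · subst he; exact h0
    have hsub : Icc t₀ t ⊆ S := hS.ordConnected.out ht₀ ht
    have h' : IsClassicalNSSolutionOn (Icc t₀ t) ν f u p := h.mono hsub (uniqueDiffOn_Icc hlt)
    have hdec : ∀ δ : ℝ, 0 < δ → ∃ R : ℝ, ∀ s ∈ Icc t₀ t, ∀ y : EuclideanSpace ℝ (Fin 2),
        R ≤ ‖y‖ → |PlanarEigenmode.vorticity (u s) y| ≤ δ := fun δ hδ => by
      obtain ⟨R, hR⟩ := decay_of_hasUniformRapidDecayOn₃ hω δ hδ
      exact ⟨R, fun s hs y hy => hR s (hsub hs) y hy⟩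
    exact fun y =>
      h'.planarVorticity_ge_of_ge hν (fun s hs z => (hcurl s (hsub hs) z).symm.le) hdec h0
        (right_mem_Icc.2 htt) y
  -- data at time `t`
  have hωc : Continuous (PlanarEigenmode.vorticity (u t)) :=
    continuous_planarVorticity₃ (contDiff_infty.1 (h.contDiff_velocity ht) 1)
  obtain ⟨⟨A, hA⟩, hωi, hω1, hω2⟩ := moments_integrable_of_hasUniformRapidDecayOn hω ht hωc
  have hU' : ∀ x, ‖biotSavart2D (PlanarEigenmode.vorticity (u t)) x‖ ≤ U := fun x => by
    rw [← hBS t ht x]; exact hU x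
  -- the static floor at time `t`, then MB Prop. 1.14
  have hst := pow_three_integral_le_of_norm_biotSavart2D_le hωc hωi hA hlo hω1 hω2 hU'
  obtain ⟨hΓ, -, hM⟩ := h.planarVorticity_moments_eq hS hω hBS hcurl ht₀ ht 0
  rwa [hΓ, hM] at hst

end Planar

end Literature.Analysis.FluidPDE

end
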